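import Summits.NavierStokesRegularity.NavierStokesRegularity.Theorems.TypeILiouvilleTypeIliouvilleNoTypeIIEternalInheritanceTransfer
import Summits.NavierStokesRegularity.NavierStokesRegularity.Theses.TypeILiouville
import HarnessLib

/-!
# Crux `TypeIliouvilleNoTypeII` (stmt-NavierStokesRegularity-0056), line `eternal_split` in the
# PRESSURE-FREE currency: `NoTypeII ⇐ S₁′ ∧ EEL′`, kernel-closed

The registered line `Cruxes/TypeIliouvilleNoTypeII/Lines/eternal_split.lean` cuts the hard core
«no Type-II blow-up» into S₁ (energy-Type-I on a final slab: Albritton–Barker's `𝐈 < ∞` with the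
pressure term `D`), stub 2 (a Type-II blow-up with S₁ generates a bounded ETERNAL profile inheriting
`𝐈 < ∞`) and EEL (eternal energy Liouville).  The pressure side of stub 2 (a classical pressure for
the limit and the `D` term) is not assemblable from tree parts today (ns-typeII-p2, STATUS
2026-08-26T16:08:52Z); the velocity side is (`…EternalInheritance.lean`,
`…EternalInheritanceTransfer.lean`, on p2's Type-II zoom package).  This file records the resulting
PRESSURE-FREE version of the line, closed in the kernel:

* S₁′ (hypothesis `hS`, per solution `D ν T u p`): the viscosity-normalised solution
  `ũ = timeRescale ν⁻¹ ν⁻¹ u` has its scaled slice energies `A`, cubes `C` and dissipations `E`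
  (classical gradient) bounded by some `I < ⊤` on every parabolic ball of some final slab
  `(S₁, νT) × ℝ³` — WEAKER than S₁ (no pressure term) up to the viscosity normalisation;
* EEL′ (hypothesis `hEEL`): a bounded eternal Oseen-mild smooth divergence-free field on `ℝ × ℝ³`,
  `‖v‖ ≤ 2`, whose `A`, `C`, `E` are bounded by a finite constant on ALL parabolic balls, vanishes at
  the origin — STRONGER than EEL as a Liouville statement (weaker hypothesis on `v`), still implied by
  KNSS's conjecture (L) restricted to such fields, and with teeth exactly where (L) is open: constants
  and steady states (p2's rigidity rungs);
* `isTypeIBlowup_of_pressureFreeSlab_of_eternalLiouville` — per solution (the door calculus' KILL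
  shape): frame ∧ S₁′-clause ∧ EEL′ ⇒ `IsTypeIBlowup u T`;
* `typeIliouvilleNoTypeII_of_pressureFreeSlab_of_eternalLiouville` — the crux BY NAME from
  (∀ blow-ups, S₁′-clause) and EEL′;
* `pressureFreeSlab_of_typeIBound_lt_top` — at unit viscosity the registered stub-1 conclusion
  `typeIBound ((T - r², T) × ℝ³; u, p, ∇u) < ⊤` gives the S₁′-clause (each of `A`, `C`, `E` is a summand
  of `abScaledSum ≤ typeIBound`; `timeRescale 1⁻¹ 1⁻¹ u = u`), so S₁ ⇒ S₁′ at `ν = 1`.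

WHAT THIS IS NOT: not NS and not a proof of `NoTypeII` — S₁′ and EEL′ are OPEN; this is the
composition certificate that they suffice, with every other step a tree theorem. [folklore]
-/

noncomputable section

-- the summit and its single problem share the name (D-0017 nested layout)
set_option linter.dupNamespace false

open MeasureTheory Set Function Filter TopologicalSpace Metric
open scoped Topology NNReal ENNReal

namespace Summit.NavierStokesRegularity.NavierStokesRegularity.Theorems.TypeIliouvilleNoTypeII.EternalSplit

open Literature.Analysis Literature.Analysis.FluidPDE
open Summit.NavierStokesRegularity.NavierStokesRegularity.Theses.TypeILiouville (TypeIliouvilleNoTypeII)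

variable {ν T : ℝ} {u : ℝ → EuclideanSpace ℝ (Fin 3) → EuclideanSpace ℝ (Fin 3)}
  {p : ℝ → EuclideanSpace ℝ (Fin 3) → ℝ}

/-! ### The kill: S₁′-clause ∧ EEL′ ⇒ Type-I rate, per solution -/

/-- **KILL, per solution.** A maximal smooth Leray–Hopf solution from a rapidly decaying datum whose
viscosity-normalised field has `A`, `C`, `E` bounded by a finite `I` on every ball of a final slab
(the S₁′-clause) blows up at the Type-I rate, PROVIDED the pressure-free eternal energy Liouville
statement EEL′ holds: otherwise the Type-II zoom package would produce an eternal profile with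
`‖v(0,0)‖ ≥ 1/2` and finite pressure-free Type-I quantity
(`exists_eternalProfile_pressureFree_of_not_isTypeIBlowup`), which EEL′ kills. [folklore] -/
theorem isTypeIBlowup_of_pressureFreeSlab_of_eternalLiouville (hν : 0 < ν) (hT : 0 < T)
    (hmax : IsMaximalSmoothSolution ν 0 u p T) (hLH : IsLerayHopfOn T ν 0 (u 0) u)
    (hdec : HasRapidSpatialDecay (u 0))
    (hS : ∃ S₁ : ℝ, S₁ < ν * T ∧ ∃ I : ℝ≥0∞, I ≠ ⊤ ∧
      (∀ r : ℝ, 0 < r → ∀ z : ℝ × EuclideanSpace ℝ (Fin 3),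
        parabolicCylinder r z ⊆ Ioo S₁ (ν * T) ×ˢ univ →
        cknAEss r z (timeRescale ν⁻¹ ν⁻¹ u) ≤ I ∧ cknC r z (timeRescale ν⁻¹ ν⁻¹ u) ≤ I ∧
        cknE r z (fun s y => fderiv ℝ (timeRescale ν⁻¹ ν⁻¹ u s) y) ≤ I))
    (hEEL : ∀ v : ℝ → EuclideanSpace ℝ (Fin 3) → EuclideanSpace ℝ (Fin 3),
      ContDiff ℝ (⊤ : ℕ∞) (uncurry v) → (∀ t, VectorCalculus.IsDivFree (v t)) →
      (∀ s t : ℝ, s < t → ∀ x, v t x = heatFlow (v s) (t - s) x - oseenDuhamel 1 s v v t x) →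
      (∀ t x, ‖v t x‖ ≤ 2) →
      (∃ I : ℝ≥0∞, I ≠ ⊤ ∧ ∀ r : ℝ, 0 < r → ∀ z : ℝ × EuclideanSpace ℝ (Fin 3),
        cknAEss r z v ≤ I ∧ cknC r z v ≤ I ∧ cknE r z (fun s y => fderiv ℝ (v s) y) ≤ I) →
      v 0 0 = 0) :
    IsTypeIBlowup u T := by
  by_contra hII
  obtain ⟨S₁, hS₁, I, hI, hQ⟩ := hS
  obtain ⟨v, hv, hdiv, hmild, hvbd, h0, hvQ⟩ :=
    exists_eternalProfile_pressureFree_of_not_isTypeIBlowup hν hT hmax hLH hdec hII hS₁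
      (fun r hr z hz => (hQ r hr z hz).1) (fun r hr z hz => (hQ r hr z hz).2.1)
      (fun r hr z hz => (hQ r hr z hz).2.2)
  have h00 : v 0 0 = 0 := hEEL v hv hdiv hmild hvbd ⟨I, hI, hvQ⟩
  rw [h00, norm_zero] at h0
  linarith

/-! ### The crux by name: `NoTypeII ⇐ S₁′ ∧ EEL′` -/

/-- **`NoTypeII` from the pressure-free slab bound S₁′ and the pressure-free eternal energy
Liouville statement EEL′** (the line `eternal_split` in the pressure-free currency, composed BY NAME:
every other step — Type-II doubling windows, extraction of the eternal limit, transport and lower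
semicontinuity of `A`, `C`, `E` — is a tree theorem). [folklore] -/
theorem typeIliouvilleNoTypeII_of_pressureFreeSlab_of_eternalLiouville
    (hS : ∀ (ν T : ℝ), 0 < ν → 0 < T →
      ∀ (u : ℝ → EuclideanSpace ℝ (Fin 3) → EuclideanSpace ℝ (Fin 3))
        (p : ℝ → EuclideanSpace ℝ (Fin 3) → ℝ),
      IsMaximalSmoothSolution ν 0 u p T → IsLerayHopfOn T ν 0 (u 0) u → HasRapidSpatialDecay (u 0) →
      ∃ S₁ : ℝ, S₁ < ν * T ∧ ∃ I : ℝ≥0∞, I ≠ ⊤ ∧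
        (∀ r : ℝ, 0 < r → ∀ z : ℝ × EuclideanSpace ℝ (Fin 3),
          parabolicCylinder r z ⊆ Ioo S₁ (ν * T) ×ˢ univ →
          cknAEss r z (timeRescale ν⁻¹ ν⁻¹ u) ≤ I ∧ cknC r z (timeRescale ν⁻¹ ν⁻¹ u) ≤ I ∧
          cknE r z (fun s y => fderiv ℝ (timeRescale ν⁻¹ ν⁻¹ u s) y) ≤ I))
    (hEEL : ∀ v : ℝ → EuclideanSpace ℝ (Fin 3) → EuclideanSpace ℝ (Fin 3),
      ContDiff ℝ (⊤ : ℕ∞) (uncurry v) → (∀ t, VectorCalculus.IsDivFree (v t)) →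
      (∀ s t : ℝ, s < t → ∀ x, v t x = heatFlow (v s) (t - s) x - oseenDuhamel 1 s v v t x) →
      (∀ t x, ‖v t x‖ ≤ 2) →
      (∃ I : ℝ≥0∞, I ≠ ⊤ ∧ ∀ r : ℝ, 0 < r → ∀ z : ℝ × EuclideanSpace ℝ (Fin 3),
        cknAEss r z v ≤ I ∧ cknC r z v ≤ I ∧ cknE r z (fun s y => fderiv ℝ (v s) y) ≤ I) →
      v 0 0 = 0) :
    TypeIliouvilleNoTypeII :=
  fun ν T hν hT u p hmax hLH hdec =>
    isTypeIBlowup_of_pressureFreeSlab_of_eternalLiouville hν hT hmax hLH hdec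
      (hS ν T hν hT u p hmax hLH hdec) hEEL

/-! ### Unit viscosity: the registered stub-1 conclusion gives the S₁′-clause -/

/-- At unit viscosity the normalisation is the identity: `timeRescale 1⁻¹ 1⁻¹ u = u`. [folklore] -/
theorem timeRescale_inv_one (u : ℝ → EuclideanSpace ℝ (Fin 3) → EuclideanSpace ℝ (Fin 3)) :
    timeRescale (1 : ℝ)⁻¹ (1 : ℝ)⁻¹ u = u := by
  funext s x
  rw [timeRescale_apply, inv_one, one_smul, one_mul]

/-- `A ≤ A + C + D + E`. [folklore] -/
theorem cknAEss_le_abScaledSum (r : ℝ) (z : ℝ × EuclideanSpace ℝ (Fin 3))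
    (u : ℝ → EuclideanSpace ℝ (Fin 3) → EuclideanSpace ℝ (Fin 3)) (p : ℝ → EuclideanSpace ℝ (Fin 3) → ℝ)
    (G : ℝ → EuclideanSpace ℝ (Fin 3) → EuclideanSpace ℝ (Fin 3) →L[ℝ] EuclideanSpace ℝ (Fin 3)) :
    cknAEss r z u ≤ abScaledSum r z u p G := by
  unfold abScaledSum
  exact le_add_right (le_add_right le_self_add)

/-- `C ≤ A + C + D + E`. [folklore] -/
theorem cknC_le_abScaledSum (r : ℝ) (z : ℝ × EuclideanSpace ℝ (Fin 3))
    (u : ℝ → EuclideanSpace ℝ (Fin 3) → EuclideanSpace ℝ (Fin 3)) (p : ℝ → EuclideanSpace ℝ (Fin 3) → ℝ)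
    (G : ℝ → EuclideanSpace ℝ (Fin 3) → EuclideanSpace ℝ (Fin 3) →L[ℝ] EuclideanSpace ℝ (Fin 3)) :
    cknC r z u ≤ abScaledSum r z u p G := by
  unfold abScaledSum
  exact le_add_right (le_add_right le_add_self)

/-- `E ≤ A + C + D + E`. [folklore] -/
theorem cknE_le_abScaledSum (r : ℝ) (z : ℝ × EuclideanSpace ℝ (Fin 3))
    (u : ℝ → EuclideanSpace ℝ (Fin 3) → EuclideanSpace ℝ (Fin 3)) (p : ℝ → EuclideanSpace ℝ (Fin 3) → ℝ)
    (G : ℝ → EuclideanSpace ℝ (Fin 3) → EuclideanSpace ℝ (Fin 3) →L[ℝ] EuclideanSpace ℝ (Fin 3)) :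
    cknE r z G ≤ abScaledSum r z u p G := by
  unfold abScaledSum
  exact le_add_self

/-- **S₁ ⇒ S₁′ at unit viscosity.** If `ν = 1` and Albritton–Barker's full Type-I quantity of
`(u, p, ∇u)` is finite on the final slab `(T - r², T) × ℝ³`, `0 < r` — the conclusion of the
registered stub `stub_energyTypeISlab` — then the S₁′-clause holds with `S₁ = T - r²` and
`I = 𝐈((T - r², T) × ℝ³)`. [folklore] -/
theorem pressureFreeSlab_of_typeIBound_lt_top {r : ℝ} (hr : 0 < r)
    (hI : typeIBound (Ioo (T - r ^ 2) T ×ˢ univ) u p (fun t y => fderiv ℝ (u t) y) < ⊤) :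
    ∃ S₁ : ℝ, S₁ < 1 * T ∧ ∃ I : ℝ≥0∞, I ≠ ⊤ ∧
      (∀ r' : ℝ, 0 < r' → ∀ z : ℝ × EuclideanSpace ℝ (Fin 3),
        parabolicCylinder r' z ⊆ Ioo S₁ (1 * T) ×ˢ univ →
        cknAEss r' z (timeRescale (1 : ℝ)⁻¹ (1 : ℝ)⁻¹ u) ≤ I ∧
        cknC r' z (timeRescale (1 : ℝ)⁻¹ (1 : ℝ)⁻¹ u) ≤ I ∧
        cknE r' z (fun s y => fderiv ℝ (timeRescale (1 : ℝ)⁻¹ (1 : ℝ)⁻¹ u s) y) ≤ I) := by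
  refine ⟨T - r ^ 2, by nlinarith, _, hI.ne, fun r' hr' z hz => ?_⟩
  rw [one_mul] at hz
  rw [timeRescale_inv_one]
  have hle := abScaledSum_le_typeIBound (u := u) (p := p) (G := fun t y => fderiv ℝ (u t) y) hr' hz
  exact ⟨(cknAEss_le_abScaledSum _ _ _ _ _).trans hle, (cknC_le_abScaledSum _ _ _ _ _).trans hle,
    (cknE_le_abScaledSum _ _ _ _ _).trans hle⟩

/-- **At unit viscosity, the registered line closes modulo EEL′**: for `ν = 1`, a maximal smooth
Leray–Hopf solution from a rapidly decaying datum with `𝐈((T - r², T) × ℝ³; u, p, ∇u) < ⊤` for some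
`0 < r` (stub 1 of `eternal_split`) blows up at the Type-I rate, provided EEL′. [folklore] -/
theorem isTypeIBlowup_of_typeIBound_lt_top_of_eternalLiouville (hT : 0 < T)
    (hmax : IsMaximalSmoothSolution 1 0 u p T) (hLH : IsLerayHopfOn T 1 0 (u 0) u)
    (hdec : HasRapidSpatialDecay (u 0)) {r : ℝ} (hr : 0 < r)
    (hI : typeIBound (Ioo (T - r ^ 2) T ×ˢ univ) u p (fun t y => fderiv ℝ (u t) y) < ⊤)
    (hEEL : ∀ v : ℝ → EuclideanSpace ℝ (Fin 3) → EuclideanSpace ℝ (Fin 3),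
      ContDiff ℝ (⊤ : ℕ∞) (uncurry v) → (∀ t, VectorCalculus.IsDivFree (v t)) →
      (∀ s t : ℝ, s < t → ∀ x, v t x = heatFlow (v s) (t - s) x - oseenDuhamel 1 s v v t x) →
      (∀ t x, ‖v t x‖ ≤ 2) →
      (∃ I : ℝ≥0∞, I ≠ ⊤ ∧ ∀ r : ℝ, 0 < r → ∀ z : ℝ × EuclideanSpace ℝ (Fin 3),
        cknAEss r z v ≤ I ∧ cknC r z v ≤ I ∧ cknE r z (fun s y => fderiv ℝ (v s) y) ≤ I) →
      v 0 0 = 0) :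
    IsTypeIBlowup u T :=
  isTypeIBlowup_of_pressureFreeSlab_of_eternalLiouville one_pos hT hmax hLH hdec
    (pressureFreeSlab_of_typeIBound_lt_top hr hI) hEEL

end Summit.NavierStokesRegularity.NavierStokesRegularity.Theorems.TypeIliouvilleNoTypeII.EternalSplit

end
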